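import Literature.AlgebraicGeometry.HodgeTheory.WeilClasses
import Literature.AlgebraicGeometry.Motives.WeilTypeCM
import Literature.AlgebraicGeometry.Motives.FamiliesVHS
import Literature.AlgebraicGeometry.HodgeTheory.GlobalInvariantCycles
import Literature.AlgebraicGeometry.HodgeTheory.HodgeModelExistence
import Literature.AlgebraicGeometry.HodgeTheory.FermatHypersurfaceReduction
import Literature.AlgebraicGeometry.Motives.CurveNet
import Literature.AlgebraicGeometry.Motives.VarietiesUnitProofs
import Literature.AlgebraicGeometry.Motives.VarietiesDimensionProofs
import Literature.AlgebraicGeometry.Motives.AbelianVarietyProjectiveChart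
import Literature.AlgebraicGeometry.HodgeTheory.GlobalInvariantCyclesSectionsProofs
import Literature.AlgebraicGeometry.HodgeTheory.MotivatedClassesDeformationInputs
import Summits.HodgeConjecture.HodgeConjecture.Theorems.HeckePrymWeilWeilTwelvefoldsSqrtMinus7HodgeModelFacts

/-!
# Crux `HodgeAbelianVarieties` (stmt-HodgeConjecture-1333), line `subtorus-gallery-bloch-seeds` — stub `stub_cmAnchoredFamilies` (`CMFamilies[]`): audit, the proved conjunct, the CM sector, and the honest remainder

The registered stub `stub_cmAnchoredFamilies : CMFamilies[]` (skeleton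
`Cruxes/HodgeAbelianVarieties/Lines/subtorus-gallery-bloch-seeds.lean`) is (a) every complex abelian
variety has a Hodge model, and (b) the CM-ANCHORED PACKAGING: every rational `(p,p)`-class `c` on `A`
is `e^* G` for a global class `G ∈ H²ᵖ(𝒳(ℂ); ℂ)` of a smooth projective family `f : 𝒳 ⟶ S` over a
smooth irreducible quasi-projective complex base with `A` the fibre at `t`, a CM fibre `A₀` at `s₀`,
and `G` rational `(p,p)` on every abelian fibre. In print (b) is the universal family over the fine
moduli scheme, the component of the locus of Hodge classes through `(A, c)` (Cattani–Deligne–Kaplan),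
CM points on its image (a Mumford–Tate domain orbit), a resolution, and the théorème de la partie fixe
on a smooth compactification. VERDICT: TRUE in print, HONESTLY TYPED, NOT provable today (no moduli
scheme / universal family / period map in the tree; CDK only as a parametrised `Prop`; no Hironaka;
`deligne_globalInvariantCycles` unproved). PROVED here (axioms `propext`/`Classical.choice`/`Quot.sound`):

* `cmFamilies_nonempty_hodgeModel` — **conjunct (a)**, from the tree's theorem
  `nonempty_hodgeModel_all_holds`; `cmFamilies_iff_forall_cmPackaged` — the stub IS clause (b).
* `cmPackaged_of_isCM` — **the CM sector of (b) is the constant family** `A ⟶ Spec ℂ = 𝟙_`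
  (`isSmoothProjective_unit_holds`; every fibre inclusion is an isomorphism, `isIso_fiberι_toUnit`;
  `G = c`, `e = e₀ = 𝟙 A`; `HodgeAlong` by `IsOfHodgeType.map_of_iso` and `dim B = dim A` from
  `schemeDim_eq_holds`); `cmFamilies_of_forall_not_isCM` — only NON-CM `A` remain;
  `cmPackaged_of_dim_eq_zero` — the degenerate end `dim A = 0` (`IsCM` vacuous) is harmless.
* `fiberClass_section_eq_of_eq` — **identity principle for flat sections on the real carriers**: two
  continuous sections of the espace étalé `FiberClass f k → S(ℂ)` over a smooth irreducible
  quasi-projective base agreeing at one point agree (Ehresmann + flatness, proved in the tree).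
* `cmPackaged_of_hodgeLocusCMSection`, `stub_cmAnchoredFamilies_of_hodgeLocusCMSection_of_hironaka_of_deligne`
  — **the honest reduction** `HodgeLocusCMSection[] → Hironaka[] → deligne_globalInvariantCycles →
  CMFamilies[]`: the ONLY moduli-theoretic input is a CM-anchored family over the Hodge locus with a
  CONTINUOUS section of `FiberClass f (2p)` through `c` valued in rational `(p,p)`-classes (no global
  class asked); Hironaka (shape of the tree's `Andre1996_deformation_hcomp_of_hironaka`) and Deligne's
  named fact produce `G`, which restricts to the section on EVERY fibre by the identity principle.

JUNK AUDIT of the typed `CMFamilies[]`. (i) Not junk-provable: the only constructible family is the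
constant one, which forces `A₀ ≅ A`, i.e. `IsCM[A]`; `IsCM[A₀]` is vacuous only for `dim A₀ = 0` and
`dim A₀ = dim A` is forced (`schemeDim_eq_holds`); `S` smooth AND irreducible excludes two-point and
non-reduced bases; `G = 0` packages only `c = 0` and still needs a genuine family to a CM fibre;
`HodgeAlong` binds abelian-variety presentations only, but in a smooth projective family over a
connected base with one abelian fibre all fibres are abelian (Mumford, GIT Thm. 6.14, étale-locally).
(ii) Not false for a silly reason: for the honest family `fiberOver f t = 𝒳 ×_S Spec ℂ ≅ A.X` (fine
moduli), abelian `g`-folds are `IsSmoothProjective g`, a resolved component is quasi-projective smooth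
irreducible, a CM fibre has an endomorphism with `2g` distinct eigenvalues on `H¹`, and everything is
in universe `0`. MISSING, nameably: `A_{g,d,n}/ℂ` with its universal abelian scheme and the modular
isomorphism (GIT Thm. 7.9); the Gauss–Manin `GeometricVHSData` and CDK Thm. 1.1 as a closed statement;
Mumford–Tate domains with CM points (GGK II.C.1, VI.C.1; Kerr 12.5.5); `Hironaka[]`; a proof of
`deligne_globalInvariantCycles`.
-/

set_option linter.dupNamespace false

noncomputable section

open CategoryTheory
open Literature.AlgebraicGeometry Literature.AlgebraicGeometry.Motives

namespace Summit.HodgeConjecture.HodgeConjecture.Cruxes.HodgeAbelianVarieties.SubtorusGalleryBlochSeeds.Stubs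

/-! ### The shared statements (copied verbatim from the registered skeleton, lines 227–266) -/

/-- `IsCM[A]` — `A` is of CM type: some endomorphism of `A` has `2 · dim A` distinct eigenvalues on
`H¹(A(ℂ); ℂ)` (equivalently `End⁰(A) ⊇` an étale commutative `ℚ`-subalgebra of rank `2 dim A`;
Mumford, *Abelian Varieties* §22; Markman survey §1.1). Local notation only. -/
local notation3 (prettyPrint := false) "IsCM[" A "]" =>
  ∃ (ψ : A ⟶ A) (μ : Fin (2 * AbelianVariety.dim A) → ℂ), Function.Injective μ ∧
    ∀ i, Module.End.HasEigenvalue (HodgeTheory.complexBetti.map ψ.hom.hom.hom 1).hom (μ i)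

/-- `FibreIncl[f, B, e, s]` — `e : B.X ⟶ 𝒳` presents the abelian variety `B` as THE fibre of
`f : 𝒳 ⟶ S` over the complex point `s` (an isomorphism with the fibre product `𝒳 ×_S Spec ℂ`, tree
`Motives.fiberOver`/`fiberι`, followed by the fibre inclusion). Local notation only. -/
local notation3 (prettyPrint := false) "FibreIncl[" f ", " B ", " e ", " s "]" =>
  ∃ i : AbelianVariety.X B ≅ fiberOver f s, e = i.hom ≫ fiberι f s

/-- `HodgeAlong[S, 𝒳, f, G, p]` — the global class `G ∈ H^{2p}(𝒳(ℂ); ℂ)` restricts to a RATIONAL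
class of Hodge type `(p,p)` on every fibre of `f` presented as an abelian variety. Local notation only. -/
local notation3 (prettyPrint := false) "HodgeAlong[" S ", " 𝒳 ", " f ", " G ", " p "]" =>
  ∀ (B : AbelianVariety ℂ) (eB : AbelianVariety.X B ⟶ 𝒳) (u : ComplexPoints S),
    FibreIncl[f, B, eB, u] →
      HodgeTheory.IsRationalClass (HodgeTheory.complexBetti.map eB (2 * p) G) ∧
      HodgeTheory.IsOfHodgeType B.dim B.X (2 * p) p p (HodgeTheory.complexBetti.map eB (2 * p) G)

/-- `CMFamilies[]` — CM-ANCHORED MUMFORD–TATE PACKAGING (stub 4): Hodge models exist for abelian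
varieties, and every rational `(p,p)`-class `c` on `A` is the restriction of a global class `G` of a
smooth projective family over a smooth irreducible quasi-projective complex base, Hodge and rational
on every abelian fibre, with a fibre of CM type. Local notation only. -/
local notation3 (prettyPrint := false) "CMFamilies[]" =>
  (∀ A : AbelianVariety ℂ, Nonempty (HodgeTheory.HodgeModel A.dim A.X)) ∧
  ∀ (A : AbelianVariety ℂ) (p : ℕ) (c : HodgeTheory.complexBetti A.X (2 * p)),
    HodgeTheory.IsRationalClass c → HodgeTheory.IsOfHodgeType A.dim A.X (2 * p) p p c →
    ∃ (S 𝒳 : SchemeOver ℂ) (f : 𝒳 ⟶ S) (G : HodgeTheory.complexBetti 𝒳 (2 * p))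
      (t s₀ : ComplexPoints S) (e : A.X ⟶ 𝒳) (A₀ : AbelianVariety ℂ) (e₀ : A₀.X ⟶ 𝒳),
      HodgeTheory.IsQuasiProjectiveOver S ∧ AlgebraicGeometry.Smooth S.hom ∧ IrreducibleSpace S.left ∧
      IsSmoothProjectiveFamily f A.dim ∧
      FibreIncl[f, A, e, t] ∧ FibreIncl[f, A₀, e₀, s₀] ∧ IsCM[A₀] ∧
      HodgeTheory.complexBetti.map e (2 * p) G = c ∧ HodgeAlong[S, 𝒳, f, G, p]

/-- `CMPackaged[A, p, c]` — the packaging clause (b) of `CMFamilies[]` for ONE triple `(A, p, c)`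
(the body of the second conjunct, same text with `A`, `p`, `c` free). Local notation only. -/
local notation3 (prettyPrint := false) "CMPackaged[" A ", " p ", " c "]" =>
  ∃ (S 𝒳 : SchemeOver ℂ) (f : 𝒳 ⟶ S) (G : HodgeTheory.complexBetti 𝒳 (2 * p))
    (t s₀ : ComplexPoints S) (e : AbelianVariety.X A ⟶ 𝒳) (A₀ : AbelianVariety ℂ) (e₀ : A₀.X ⟶ 𝒳),
    HodgeTheory.IsQuasiProjectiveOver S ∧ AlgebraicGeometry.Smooth S.hom ∧ IrreducibleSpace S.left ∧
    IsSmoothProjectiveFamily f (AbelianVariety.dim A) ∧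
    FibreIncl[f, A, e, t] ∧ FibreIncl[f, A₀, e₀, s₀] ∧ IsCM[A₀] ∧
    HodgeTheory.complexBetti.map e (2 * p) G = c ∧ HodgeAlong[S, 𝒳, f, G, p]

/-! ### Conjunct (a): Hodge models of abelian varieties (PROVED in the tree) -/

/-- **Conjunct (a) of `CMFamilies[]` holds**: every complex abelian variety has a Hodge model —
the tree's theorem `nonempty_hodgeModel_all_holds` (Serre's analytification, de Rham's theorem,
the Hodge decomposition of the compact Kähler manifold `A^an`) applied to the smooth projective
variety `A.X` (`AbelianVariety.isSmoothProjective_holds`). [cite: SerreGAGA1956, §2]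
[cite: VoisinHodgeI2002, §6.1.3 Prop. 6.11] -/
theorem cmFamilies_nonempty_hodgeModel (A : AbelianVariety ℂ) :
    Nonempty (HodgeTheory.HodgeModel A.dim A.X) :=
  Summit.HodgeConjecture.HodgeConjecture.Theorems.WeilTwelvefoldsSqrtMinus7.AmnesicSecantSheaves.nonempty_hodgeModel_all_holds
    A.dim A.X (AbelianVariety.isSmoothProjective_holds (A := A))

/-- **`CMFamilies[]` is exactly its packaging clause (b)**, conjunct (a) being a theorem
(`cmFamilies_nonempty_hodgeModel`). [folklore] -/
theorem cmFamilies_iff_forall_cmPackaged :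
    CMFamilies[] ↔ ∀ (A : AbelianVariety ℂ) (p : ℕ) (c : HodgeTheory.complexBetti A.X (2 * p)),
      HodgeTheory.IsRationalClass c → HodgeTheory.IsOfHodgeType A.dim A.X (2 * p) p p c →
        CMPackaged[A, p, c] :=
  ⟨fun h ↦ h.2, fun h ↦ ⟨cmFamilies_nonempty_hodgeModel, h⟩⟩

/-! ### The constant family over the point: the CM sector of (b) is the trivial family -/

section ConstantFamily

open MonoidalCategory AlgebraicGeometry Limits

/-- The point `Spec ℂ = 𝟙_ (SchemeOver ℂ)` is an admissible base: quasi-projective (indeed projective),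
smooth (of relative dimension `0`) and irreducible — all from `isSmoothProjective_unit_holds`. [folklore] -/
theorem unit_base : HodgeTheory.IsQuasiProjectiveOver (𝟙_ (SchemeOver ℂ)) ∧
    AlgebraicGeometry.Smooth (𝟙_ (SchemeOver ℂ)).hom ∧ IrreducibleSpace (𝟙_ (SchemeOver ℂ)).left := by
  have h := isSmoothProjective_unit_holds ℂ
  haveI := h.smoothOfRelativeDimension
  haveI := h.geometricallyIrreducible
  exact ⟨HodgeTheory.IsQuasiProjectiveOver.of_isProjectiveOver h.isProjectiveOver,
    SmoothOfRelativeDimension.smooth 0 _,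
    GeometricallyIrreducible.irreducibleSpace_of_subsingleton (𝟙_ (SchemeOver ℂ)).hom⟩

/-- Every complex point `u : Spec ℂ ⟶ Spec ℂ` of the point base has invertible underlying morphism
(`u.left ≫ 𝟙 = Spec (algebraMap ℂ ℂ)`, an isomorphism). [folklore] -/
theorem isIso_left_complexPoint_unit (u : ComplexPoints (𝟙_ (SchemeOver ℂ))) : IsIso u.left := by
  haveI : IsIso (𝟙_ (SchemeOver ℂ)).hom := IsIso.id (Spec (CommRingCat.of ℂ))
  haveI : IsIso (specOver ℂ ℂ).hom := CurveNet.isIso_specOver_self_hom ℂ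
  exact IsIso.of_isIso_fac_right (Over.w u)

variable (A : AbelianVariety ℂ)

/-- For the constant family `A ⟶ Spec ℂ`, every fibre inclusion `A ×_{Spec ℂ} Spec ℂ ⟶ A` is an
isomorphism of `ℂ`-schemes (pull-back of an isomorphism). [folklore] -/
theorem isIso_fiberι_toUnit (u : ComplexPoints (𝟙_ (SchemeOver ℂ))) :
    IsIso (fiberι (CartesianMonoidalCategory.toUnit A.X) u) := by
  haveI : IsIso u.left := isIso_left_complexPoint_unit u
  haveI : IsIso ((Over.forget (Spec (CommRingCat.of ℂ))).map
      (fiberι (CartesianMonoidalCategory.toUnit A.X) u)) :=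
    (inferInstance : IsIso (pullback.fst (CartesianMonoidalCategory.toUnit A.X).left u.left))
  exact isIso_of_reflects_iso (fiberι (CartesianMonoidalCategory.toUnit A.X) u) (Over.forget _)

/-- The constant family `A ⟶ Spec ℂ` is a smooth projective family of relative dimension `dim A`
(`A` is smooth projective of dimension `dim A`, proper, and every fibre is isomorphic to `A`).
[folklore] -/
theorem isSmoothProjectiveFamily_toUnit :
    IsSmoothProjectiveFamily (CartesianMonoidalCategory.toUnit A.X) A.dim where
  smoothOfRelativeDimension :=
    (AbelianVariety.isSmoothProjective_holds (A := A)).smoothOfRelativeDimension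
  isProper := A.isProper
  isSmoothProjective u := by
    haveI := isIso_fiberι_toUnit A u
    exact (AbelianVariety.isSmoothProjective_holds (A := A)).of_iso
      (asIso (fiberι (CartesianMonoidalCategory.toUnit A.X) u)).symm

/-- `𝟙 A` presents `A` as the fibre of the constant family over every complex point of `Spec ℂ`.
[folklore] -/
theorem fibreIncl_toUnit (u : ComplexPoints (𝟙_ (SchemeOver ℂ))) :
    FibreIncl[CartesianMonoidalCategory.toUnit A.X, A, 𝟙 A.X, u] := by
  haveI := isIso_fiberι_toUnit A u
  exact ⟨(asIso (fiberι (CartesianMonoidalCategory.toUnit A.X) u)).symm, by simp⟩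

variable {A} in
/-- Along the constant family a rational `(p,p)`-class `c` on `A` restricts to a rational `(p,p)`-class
on every fibre presented as an abelian variety `B`: the presentation is an isomorphism `B.X ≅ A.X`
(`IsRationalClass.pullback`, `IsOfHodgeType.map_of_iso`, `dim B = dim A` by `schemeDim_eq_holds`). [folklore] -/
theorem hodgeAlong_toUnit {p : ℕ} {c : HodgeTheory.complexBetti A.X (2 * p)}
    (hc : HodgeTheory.IsRationalClass c) (hh : HodgeTheory.IsOfHodgeType A.dim A.X (2 * p) p p c) :
    HodgeAlong[𝟙_ (SchemeOver ℂ), A.X, CartesianMonoidalCategory.toUnit A.X, c, p] := by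
  rintro B eB u ⟨i, rfl⟩
  haveI := isIso_fiberι_toUnit A u
  let E : B.X ≅ A.X := i ≪≫ asIso (fiberι (CartesianMonoidalCategory.toUnit A.X) u)
  have hB : IsSmoothProjective A.dim B.X := (AbelianVariety.isSmoothProjective_holds (A := A)).of_iso E.symm
  refine ⟨hc.pullback _, ?_⟩
  rw [show B.dim = A.dim from schemeDim_eq_holds hB]
  exact hh.map_of_iso E

/-- **The CM sector of clause (b) is the constant family.** If `A` is itself of CM type, then for
every rational `(p,p)`-class `c` on `A` the constant family `A ⟶ Spec ℂ` (global class `G = c`; both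
marked fibres `A` itself, presented by `𝟙 A`) satisfies clause (b) of `CMFamilies[]` — the sector of
`lineImplication` where stub 5 is not needed (HC for `A` is `HCCM[]` directly). [folklore] -/
theorem cmPackaged_of_isCM (hA : IsCM[A]) (p : ℕ) (c : HodgeTheory.complexBetti A.X (2 * p))
    (hc : HodgeTheory.IsRationalClass c) (hh : HodgeTheory.IsOfHodgeType A.dim A.X (2 * p) p p c) :
    CMPackaged[A, p, c] := by
  refine ⟨𝟙_ (SchemeOver ℂ), A.X, CartesianMonoidalCategory.toUnit A.X, c,
    CartesianMonoidalCategory.toUnit _, CartesianMonoidalCategory.toUnit _, 𝟙 A.X, A, 𝟙 A.X,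
    unit_base.1, unit_base.2.1, unit_base.2.2,
    isSmoothProjectiveFamily_toUnit A, fibreIncl_toUnit A _, fibreIncl_toUnit A _, hA, ?_,
    hodgeAlong_toUnit hc hh⟩
  rw [HodgeTheory.complexBetti.map_id]
  rfl

/-- **The degenerate end `dim A = 0` of clause (b) holds** (trivially: `IsCM[A]` is vacuous for
`dim A = 0`, the eigenvalue family being indexed by `Fin 0`, so the constant family applies). [folklore] -/
theorem cmPackaged_of_dim_eq_zero (h : A.dim = 0) (p : ℕ) (c : HodgeTheory.complexBetti A.X (2 * p))
    (hc : HodgeTheory.IsRationalClass c) (hh : HodgeTheory.IsOfHodgeType A.dim A.X (2 * p) p p c) :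
    CMPackaged[A, p, c] :=
  cmPackaged_of_isCM A ⟨0, fun _ => 0, fun i => absurd i.2 (by omega), fun i => absurd i.2 (by omega)⟩
    p c hc hh

end ConstantFamily

/-- **`CMFamilies[]` reduces to packaging the NON-CM abelian varieties**: conjunct (a) is proved and
the CM sector of (b) is the constant family. [folklore] -/
theorem cmFamilies_of_forall_not_isCM
    (h : ∀ (A : AbelianVariety ℂ), ¬ IsCM[A] → ∀ (p : ℕ) (c : HodgeTheory.complexBetti A.X (2 * p)),
      HodgeTheory.IsRationalClass c → HodgeTheory.IsOfHodgeType A.dim A.X (2 * p) p p c →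
        CMPackaged[A, p, c]) :
    CMFamilies[] := by
  refine cmFamilies_iff_forall_cmPackaged.2 fun A p c hc hh ↦ ?_
  by_cases hA : IsCM[A]
  · exact cmPackaged_of_isCM A hA p c hc hh
  · exact h A hA p c hc hh

/-! ### Flat sections on the real carriers: a continuous section of `R^k f_* ℂ` is determined by one value -/

section Sections

open AlgebraicGeometry

variable {𝒳 S : SchemeOver ℂ}

/-- Equal fibre classes have equal classes in any common fibre. [folklore] -/
theorem fiberClass_clsAt_congr {f : 𝒳 ⟶ S} {k : ℕ} {x y : HodgeTheory.FiberClass f k} (h : x = y)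
    {t : ComplexPoints S} (hx : x.pt = t) (hy : y.pt = t) : x.clsAt hx = y.clsAt hy := by
  subst h
  rfl

/-- **Identity principle for continuous sections of the espace étalé of `Rᵏ f_* ℂ`.** Over a smooth
irreducible quasi-projective complex base, two continuous sections of `FiberClass.pt` of a smooth
projective family which agree at one point agree everywhere: `S(ℂ)` is a connected complex manifold
(`ComplexPoints.connectedSpace_iff_holds`), hence path connected; `Rᵏ f_* ℂ` is a local system over
`S(ℂ)` (Ehresmann, `isCohomologicallyLocallyTrivialOn_univ_of_isSmoothProjectiveFamily`); continuous
sections are flat (`transportFun_clsAt_of_continuous`), so both values at `s` are the transport of the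
common value at `s₀`. [cite: VoisinHodgeII2003, Lemma 4.17] [cite: VoisinHodgeI2002, §9.2.1] -/
theorem fiberClass_section_eq_of_eq (f : 𝒳 ⟶ S) {n : ℕ} (hf : IsSmoothProjectiveFamily f n)
    (hS : AlgebraicGeometry.Smooth S.hom) (hSqp : HodgeTheory.IsQuasiProjectiveOver S)
    (hSirr : IrreducibleSpace S.left) (k : ℕ) {σ τ : ComplexPoints S → HodgeTheory.FiberClass f k}
    (hσ : Continuous σ) (hτ : Continuous τ) (hσpt : ∀ s, (σ s).pt = s) (hτpt : ∀ s, (τ s).pt = s)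
    {s₀ : ComplexPoints S} (h₀ : σ s₀ = τ s₀) (s : ComplexPoints S) : σ s = τ s := by
  haveI := hS; haveI := hSirr; haveI : LocallyOfFiniteType S.hom := hSqp.locallyOfFiniteType
  haveI : ConnectedSpace (ComplexPoints S) := (ComplexPoints.connectedSpace_iff_holds S).2 inferInstance
  obtain ⟨m, hm⟩ := HodgeTheory.exists_smoothOfRelativeDimension_of_connectedSpace_complexPoints S
  haveI := hm
  have hU := HodgeTheory.isCohomologicallyLocallyTrivialOn_univ_of_isSmoothProjectiveFamily f m hf hSqp
  haveI := HodgeTheory.pathConnectedSpace_complexPoints_of_smoothOfRelativeDimension S m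
  have hcont : Continuous fun x : ComplexPoints S =>
      (⟨x, Set.mem_univ x⟩ : (Set.univ : Set (ComplexPoints S))) := continuous_id.subtype_mk _
  let γ : Path (⟨s₀, Set.mem_univ s₀⟩ : (Set.univ : Set (ComplexPoints S))) ⟨s, Set.mem_univ s⟩ :=
    (PathConnectedSpace.somePath s₀ s).map hcont
  have h1 : HodgeTheory.transportFun f k hU ⟦γ⟧ ((σ s₀).clsAt (hσpt s₀)) = (σ s).clsAt (hσpt s) :=
    HodgeTheory.transportFun_clsAt_of_continuous f k hU hσ hσpt γ
  have h2 : HodgeTheory.transportFun f k hU ⟦γ⟧ ((τ s₀).clsAt (hτpt s₀)) = (τ s).clsAt (hτpt s) :=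
    HodgeTheory.transportFun_clsAt_of_continuous f k hU hτ hτpt γ
  rw [fiberClass_clsAt_congr h₀ (hσpt s₀) (hτpt s₀)] at h1
  have h3 : (σ s).clsAt (hσpt s) = (τ s).clsAt (hτpt s) := h1.symm.trans h2
  calc σ s = ⟨s, (σ s).clsAt (hσpt s)⟩ := (HodgeTheory.FiberClass.mk_clsAt _ _).symm
    _ = ⟨s, (τ s).clsAt (hτpt s)⟩ := by rw [h3]
    _ = τ s := HodgeTheory.FiberClass.mk_clsAt _ _

end Sections

/-! ### The honest remainder: clause (b) from the moduli-theoretic input, Hironaka and Deligne -/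

section Reduction

open MonoidalCategory AlgebraicGeometry

/-- `HodgeLocusCMSection[]` — **the moduli-theoretic input of clause (b) on the tree's real carriers
(HYPOTHESIS of the reduction below, not asserted).** For every `A` and every rational `(p,p)`-class
`c` on `A`: a smooth projective family `f : 𝒳 ⟶ S` of relative dimension `dim A`, projective over `S`
in Hartshorne's sense (closed `S`-immersion into `ℙᴺ × S`), over a smooth irreducible quasi-projective
complex base; `t` with `𝒳_t ≅ A`; `s₀` whose fibre is presented by a CM abelian variety `A₀`; and a
CONTINUOUS section `σ` of the espace étalé `FiberClass f (2p) → S(ℂ)` (a flat section of `R²ᵖ f_* ℂ`)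
through `c` at `t`, valued in rational `(p,p)`-classes. In print: the universal family over the fine
moduli scheme `A_{g,d,n}`, `n ≥ 3` (Mumford); the component through `(A, c)` of the locus of Hodge
classes is finite over a closed subvariety of the base (Cattani–Deligne–Kaplan Thm. 1.1 / Cor. 1.2;
Charles–Schnell Thm. 11.3.12) — resolve it, pull back, `σ` = the tautological flat section; its
image is the Mumford–Tate domain orbit through the period point of `A` (Green–Griffiths–Kerr
Thm. II.C.1), which contains CM points (Kerr, Def. 12.5.4 / Remark 12.5.5; GGK Lemma VI.C.1). None of
these objects exists in the tree. Local notation only. [cite: MumfordFogartyKirwan1994, Thm. 7.9]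
[cite: CattaniDeligneKaplan1995JAMS, Thm. 1.1 and Cor. 1.2] [cite: CharlesSchnell2014Notes, Theorem 11.3.12]
[cite: GreenGriffithsKerr2012, Thm. (II.C.1) and Lemma (VI.C.1)]
[cite: CattaniElZeinGriffithsLe2014, Ch. 12 (M. Kerr) Def. 12.5.4 and Remark 12.5.5] -/
local notation3 (prettyPrint := false) "HodgeLocusCMSection[]" =>
  ∀ (A : AbelianVariety ℂ) (p : ℕ) (c : HodgeTheory.complexBetti A.X (2 * p)),
    HodgeTheory.IsRationalClass c → HodgeTheory.IsOfHodgeType A.dim A.X (2 * p) p p c →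
    ∃ (S 𝒳 : SchemeOver ℂ) (f : 𝒳 ⟶ S) (t s₀ : ComplexPoints S) (i : A.X ≅ fiberOver f t)
      (A₀ : AbelianVariety ℂ) (e₀ : A₀.X ⟶ 𝒳) (σ : ComplexPoints S → HodgeTheory.FiberClass f (2 * p)),
      HodgeTheory.IsQuasiProjectiveOver S ∧ AlgebraicGeometry.Smooth S.hom ∧ IrreducibleSpace S.left ∧
      IsSmoothProjectiveFamily f A.dim ∧
      (∃ (N : ℕ) (ι : 𝒳 ⟶ projectiveSpace N ℂ ⊗ S), IsClosedImmersion ι.left ∧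
        ι ≫ CartesianMonoidalCategory.snd (projectiveSpace N ℂ) S = f) ∧
      FibreIncl[f, A₀, e₀, s₀] ∧ IsCM[A₀] ∧
      Continuous σ ∧ (∀ s, (σ s).pt = s) ∧
      (∀ s, σ s ∈ HodgeTheory.locusOfHodgeClasses f A.dim p) ∧
      σ t = ⟨t, HodgeTheory.complexBetti.map i.inv (2 * p) c⟩

/-- `Hironaka[]` — **smooth projective compactification** (HYPOTHESIS, not asserted; the shape `hHir`
consumed by the tree's `Andre1996_deformation_hcomp_of_hironaka`): a smooth (of relative dimension
`m`) quasi-projective irreducible `ℂ`-scheme is an open subscheme of a smooth projective variety of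
dimension `m` (resolve the projective closure). Local notation only. [cite: Hironaka1964, Main Theorem I] -/
local notation3 (prettyPrint := false) "Hironaka[]" =>
  ∀ (m : ℕ) (X : SchemeOver ℂ), SmoothOfRelativeDimension m X.hom →
    HodgeTheory.IsQuasiProjectiveOver X → IrreducibleSpace X.left →
    ∃ (Xbar : SchemeOver ℂ) (i : X ⟶ Xbar), IsSmoothProjective m Xbar ∧ IsOpenImmersion i.left

/-- **Clause (b) of `CMFamilies[]` from the moduli-theoretic input, Hironaka's compactification and
Deligne's théorème de la partie fixe.** Granting `HodgeLocusCMSection[]`, `Hironaka[]` and the tree's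
named fact `deligne_globalInvariantCycles`: the total space `𝒳` is smooth quasi-projective irreducible
(`Andre1996_deformation_hcomp_of_hironaka`, proved), so it has a smooth projective compactification
`j : 𝒳 ⟶ 𝒳̄`; Deligne's theorem at `t` gives `Ā ∈ H²ᵖ(𝒳̄(ℂ); ℂ)` with `σ(t) = (t, Ā|_{𝒳_t})`; put
`G = j^* Ā`. The global section of `G` is continuous and agrees with `σ` at `t`, hence everywhere
(`fiberClass_section_eq_of_eq`); so `G|_{𝒳_t} ≅ c` under `𝒳_t ≅ A`, and on every fibre `G` restricts to
a value of `σ`, a rational `(p,p)`-class, transported to every abelian-variety presentation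
(`IsOfHodgeType.map_of_iso`, `schemeDim_eq_holds`). CONDITIONAL on the two hypotheses and the fact.
[cite: DeligneHodgeII1971, Théorème 4.1.1] [cite: CharlesSchnell2014Notes, Theorem 11.3.4 and Proposition 11.3.5 (1)]
[cite: Hironaka1964, Main Theorem I] -/
theorem cmPackaged_of_hodgeLocusCMSection (hM : HodgeLocusCMSection[]) (hHir : Hironaka[])
    (hD : HodgeTheory.deligne_globalInvariantCycles) (A : AbelianVariety ℂ) (p : ℕ)
    (c : HodgeTheory.complexBetti A.X (2 * p)) (hc : HodgeTheory.IsRationalClass c)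
    (hh : HodgeTheory.IsOfHodgeType A.dim A.X (2 * p) p p c) : CMPackaged[A, p, c] := by
  obtain ⟨S, 𝒳, f, t, s₀, i, A₀, e₀, σ, hSqp, hS, hSirr, hf, hι, hA₀, hCM, hσ, hpt, hloc, hσt⟩ :=
    hM A p c hc hh
  -- a smooth projective compactification of the total space
  obtain ⟨m, Xbar, j, hXbar, hj⟩ :=
    HodgeTheory.Andre1996_deformation_hcomp_of_hironaka hHir f hf hι hS hSqp hSirr
  -- théorème de la partie fixe: the value of `σ` at `t` comes from `Xbar`
  obtain ⟨Ā, hĀ⟩ := hD 𝒳 Xbar S f j A.dim m hf hSqp hS hXbar.isProjectiveOver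
    hXbar.smoothOfRelativeDimension hj (2 * p) σ hσ hpt t
  set G : HodgeTheory.complexBetti 𝒳 (2 * p) := HodgeTheory.complexBetti.map j (2 * p) Ā with hG
  -- `σ` IS the global section of `G`
  have hsec : ∀ s, σ s = HodgeTheory.globalSection f (2 * p) G s :=
    fiberClass_section_eq_of_eq f hf hS hSqp hSirr (2 * p) hσ
      (HodgeTheory.continuous_globalSection f _ G) hpt (fun _ ↦ rfl) hĀ
  have hGt : HodgeTheory.complexBetti.map (fiberι f t) (2 * p) G =
      HodgeTheory.complexBetti.map i.inv (2 * p) c :=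
    (HodgeTheory.FiberClass.mk_eq_mk_iff _ _).1 ((hsec t).symm.trans hσt)
  refine ⟨S, 𝒳, f, G, t, s₀, i.hom ≫ fiberι f t, A₀, e₀, hSqp, hS, hSirr, hf, ⟨i, rfl⟩, hA₀, hCM,
    ?_, ?_⟩
  · rw [HodgeTheory.complexBetti.map_comp, CategoryTheory.comp_apply, hGt]
    exact HodgeTheory.complexBetti.map_hom_map_inv_apply i (2 * p) c
  · rintro B eB u ⟨i', rfl⟩
    obtain ⟨hrat, hhodge⟩ := (HodgeTheory.mem_locusOfHodgeClasses_iff _).1 ((hsec u) ▸ hloc u)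
    dsimp only [HodgeTheory.cls_globalSection, HodgeTheory.pt_globalSection] at hrat hhodge
    rw [HodgeTheory.complexBetti.map_comp, CategoryTheory.comp_apply]
    refine ⟨hrat.pullback _, ?_⟩
    rw [show B.dim = A.dim from schemeDim_eq_holds ((hf.isSmoothProjective u).of_iso i'.symm)]
    exact hhodge.map_of_iso i'

/-- **The registered stub in the CONDITIONAL form provable today**: conjunct (a) is the tree's theorem
(`cmFamilies_nonempty_hodgeModel`), clause (b) is `cmPackaged_of_hodgeLocusCMSection`. Antecedents, in
order: the CM-anchored Hodge-locus family with its flat section (moduli + Cattani–Deligne–Kaplan + CM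
points on Mumford–Tate domains; absent from the tree), Hironaka's compactification (absent), and the
named fact `deligne_globalInvariantCycles` (unproved). [cite: CattaniDeligneKaplan1995JAMS, Thm. 1.1 and Cor. 1.2]
[cite: Hironaka1964, Main Theorem I] [cite: DeligneHodgeII1971, Théorème 4.1.1] -/
theorem stub_cmAnchoredFamilies_of_hodgeLocusCMSection_of_hironaka_of_deligne :
    HodgeLocusCMSection[] → Hironaka[] → HodgeTheory.deligne_globalInvariantCycles → CMFamilies[] :=
  fun hM hHir hD ↦ cmFamilies_iff_forall_cmPackaged.2 fun A p c hc hh ↦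
    cmPackaged_of_hodgeLocusCMSection hM hHir hD A p c hc hh

end Reduction

end Summit.HodgeConjecture.HodgeConjecture.Cruxes.HodgeAbelianVarieties.SubtorusGalleryBlochSeeds.Stubs

end
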